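/-
Copyright (c) 2026 the pub-hodgecm-mathlib formalisation cell (harness21).  Prover seat hodgecm-mathlib-K2E4-p11 (g6), Track B ∕ K2-LIT, h413 = `stmt-HodgeConjecture-24833`,
line `K2_E1_TraceFormulaBeta`, campaign «5Res ENDGAME BY FAMILIES», ROADCARD §3′ (M2 v2), the K-TYPE ⇒ LEVEL reduction (dealer K2E1-plan (g7) deal (233)), FILE 2: an irreducible finite-
dimensional `K`-type of `K ⊇ K_∞·K_f` (`K_∞` central-by-abelian, `K_f` profinite) is a CHARACTER `τ` on `K_∞` and TRIVIAL on an open subgroup `U ≤ K_f`, so its isotypic component sits in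
`π^{(τ, U)}`; hence «`π^{(τ,U)}` finite-dimensional ∀ (τ, U)» ⟹ `K`-admissibility (★ `hadm` currency of `residualSpectrumCompact_of_admissible`).
-/
import Summits.HodgeConjecture.HodgeConjecture.Theorems.K2E1NoSmallSubgroupsGL   -- ★ FILE 1 (this seat): Banach-algebra units have no small subgroups (`exists_forall_monoidHom_eq_one`)
import Literature.NumberTheory.Automorphic.UnitaryIsotypicProjection            -- ★ `Representation.homRangeSum`, `ContRepresentation.subRep` (the `hadm` currency)
import Mathlib.Topology.Algebra.OpenSubgroup
import Mathlib.Topology.Separation.Profinite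
import Mathlib.Analysis.Normed.Module.FiniteDimension
import Mathlib.LinearAlgebra.Eigenspace.Basic
import HarnessLib

/-!
# K-TYPE ⇒ LEVEL, FILE 2 — `K2E1KTypeLevelReductionU`: irreducible `K`-types are (character on the abelian central part) ⊗ (trivial on an open subgroup of the profinite part); the
# isotypic component lies in `π^{(τ,U)}`; «`dim π^{(τ,U)} < ∞ ∀ (τ,U)`» ⟹ `K`-admissibility (Mathlib + ★ Literature only)

Track B ∕ K2-LIT, crux h413 = `stmt-HodgeConjecture-24833`, route of record `HCCMUnconditional`; cell `hodgecm-mathlib`, squad K2, ENGINE E1; dealer K2E1-plan (g7) deal (233): «FILE 2 — for a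
compact group `K`, a continuous hom `ιf : K_f →* K` from a PROFINITE group commuting with an abelian compact `K_∞ →* K` generating `K` (or simply `K = K_∞ × K_f`), and a finite-dim irreducible
continuous `K`-rep `E`: (a) `K_∞` acts on `E` by a CHARACTER `τ` (Schur); (b) `∃ U : OpenSubgroup K_f, ∀ u ∈ U, ρ_E u = 1` (FILE 1 + open-subgroup basis); (c) COROLLARY in ★ `ContRepresentation`
currency: every vector of the `E`-isotypic component `Representation.homRangeSum (π.restrict ιK) E` is `ι_f(U)`-FIXED and `K_∞`-`τ`-isotypic ⟹ `homRangeSum … E ≤ π^{(τ, U)}` — so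
«`(L²_res)^{(τ,K_f(𝔫))}` finite-dim ∀ τ 𝔫» ⟹ the admissibility hypothesis of ★ `residualSpectrumCompact_of_admissible` :256».  THEOREMS ONLY (no `def`, no `instance`, no `notation`, no
`sorry`; default heartbeats); lane `--supports stmt-HodgeConjecture-24833 --as helper` (count-neutral).  ABSTRACT: any group `K`, any complex Hilbert space `H`, `σ : ContRepresentation ℂ K H`
(in E1: `σ = (L²_res).toContRep.restrict ιK`); the «central» hypothesis `∀ t k, ιa t * k = k * ιa t` is what `K = K_∞ × K_f` with `K_∞` abelian gives.

THE MATHEMATICS ([BorelJacquet1979, §1.2 ∕ 4.2 (admissibility: `K`-types vs. level)]; [MoeglinWaldspurger1995, I.2.17]; [Knapp1986, Prop. 1.5 (Schur)]; [MontgomeryZippin1955, §2.10]).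
(§1 = (b)) A continuous monoid hom `ρ : K_f → 𝔸` from a profinite group into a complex Banach algebra is `1` on an OPEN SUBGROUP: `{‖ρ − 1‖ < ε}` is an open neighbourhood of `1`, contains
a clopen one (Mathlib `compact_exists_isClopen_in_isOpen`), hence an open subgroup `U` (Mathlib `exist_openSubgroup_sub_clopen_nhds_of_one`), and `ρ(U)` is a subgroup of `𝔸ˣ` inside
`B(1, ε)`, trivial by ★ FILE 1.  Applied to the (norm-continuous, `E` being finite-dimensional: Mathlib `continuous_clm_apply`) representation of `K_f` on a stable finite-dimensional `E`:
**`∃ U, ∀ u ∈ U, σ(ι_f u)|_E = 1`**.  (§2 = (a)) SCHUR: an element `z` commuting with `K` acts on an IRREDUCIBLE finite-dimensional `E` by a scalar (`σ_E(z)` is a self-intertwiner;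
Mathlib `algebraMap_intertwiningMap_bijective_of_isAlgClosed`), and along a hom `ιa : T →* K` with `K`-central image the scalars form a CHARACTER `χ : T →* ℂ`.  (§3 = (c)) Every `K`-map
`E → H` carries these relations along: the `E`-isotypic component ★ `homRangeSum σ E` consists of vectors FIXED by `ι_f(U)` and `χ`-ISOTYPIC under `ιa(T)`, i.e. lies in the submodule
`⨅_{u ∈ U} Eig(σ(ι_f u); 1) ⊓ ⨅_t Eig(σ(ιa t); χ t)` («`π^{(χ,U)}`», Mathlib `Module.End.eigenspace`); HEAD: if all these are finite-dimensional, `σ` is `K`-ADMISSIBLE in the ★ `hadm` currency.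
* §1 **`exists_openSubgroup_forall_map_eq_one`** (abstract `ρ : K_f →* 𝔸`), **`exists_openSubgroup_forall_apply_eq`** (`σ(ι_f u) v = v` on a stable finite-dimensional `E`).
* §2 **`exists_smul_of_forall_commute`** (Schur for a `K`-central element), **`exists_character_of_central`** (`χ : T →* ℂ` with `σ(ιa t) v = χ t • v` on `E`).
* §3 `homRangeSum_le_of_relations`, **`exists_level_character_homRangeSum_le`**, HEAD **`finiteDimensional_homRangeSum_of_level_finite`** (= `hadm` from «`dim π^{(χ,U)} < ∞`»).
HONEST LABEL: HC_CM is proved only modulo the 7 printed citations (2 remaining named inputs: hLiu418 = `stmt-HodgeConjecture-24832`, h413 = `stmt-HodgeConjecture-24833`) until rung 0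
closes; this file asserts no named fact, closes no socket; count-neutral; letter-free.

## References
* [BorelJacquet1979] A. Borel, H. Jacquet, *Automorphic forms and automorphic representations*, Proc. Symp. Pure Math. 33.1 (1979), §1.2, §4.2.
* [MoeglinWaldspurger1995] C. Mœglin, J.-L. Waldspurger, *Spectral decomposition and Eisenstein series* (1995), I.2.17.
* [Knapp1986] A. W. Knapp, *Representation Theory of Semisimple Groups* (1986), Prop. 1.5.
* [MontgomeryZippin1955] D. Montgomery, L. Zippin, *Topological Transformation Groups* (1955), §2.10.
-/

set_option autoImplicit false
set_option linter.dupNamespace false  -- the mandated namespace repeats the summit's segment (`HodgeConjecture.HodgeConjecture`)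

noncomputable section

open Set Filter Topology Metric
open Summit.HodgeConjecture.HodgeConjecture.Cruxes.H413.K2E1NoSmallSubgroupsGL

namespace Summit.HodgeConjecture.HodgeConjecture.Cruxes.H413.K2E1KTypeLevelReductionU

/-! ## §1 Profinite part: a finite-dimensional (Banach) representation is trivial on an open subgroup -/

section Profinite

variable {Kf : Type*} [Group Kf] [TopologicalSpace Kf] [IsTopologicalGroup Kf] [CompactSpace Kf] [T2Space Kf] [TotallyDisconnectedSpace Kf]

/-- **A CONTINUOUS HOM FROM A PROFINITE GROUP INTO A COMPLEX BANACH ALGEBRA IS `1` ON AN OPEN SUBGROUP** (`{‖ρ − 1‖ < ε}` ⊇ clopen ⊇ open subgroup `U`; `ρ(U) ≤ 𝔸ˣ` has no room: ★ FILE 1).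
[cite: MontgomeryZippin1955, §2.10] [cite: MoeglinWaldspurger1995, I.2.17] -/
theorem exists_openSubgroup_forall_map_eq_one {𝔸 : Type*} [NormedRing 𝔸] [NormedAlgebra ℂ 𝔸] [CompleteSpace 𝔸] (ρ : Kf →* 𝔸) (hρ : Continuous ρ) :
    ∃ U : OpenSubgroup Kf, ∀ u ∈ U, ρ u = 1 := by
  obtain ⟨ε, hε, hH⟩ := exists_forall_monoidHom_eq_one ℂ (𝔸 := 𝔸) Kf
  have hWo : IsOpen {k : Kf | ‖ρ k - 1‖ < ε} := isOpen_lt (continuous_norm.comp (hρ.sub continuous_const)) continuous_const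
  have h1W : (1 : Kf) ∈ {k : Kf | ‖ρ k - 1‖ < ε} := by
    simp only [mem_setOf_eq, map_one, sub_self, norm_zero]
    exact hε
  obtain ⟨V, hVc, h1V, hVW⟩ := compact_exists_isClopen_in_isOpen hWo h1W
  obtain ⟨U, hUV⟩ := IsTopologicalGroup.exist_openSubgroup_sub_clopen_nhds_of_one hVc h1V
  refine ⟨U, fun u hu => ?_⟩
  have h := hH ρ.toHomUnits (U : Subgroup Kf) (fun v hv => hVW (hUV ((OpenSubgroup.mem_toSubgroup).1 hv))) u ((OpenSubgroup.mem_toSubgroup).2 hu)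
  have h' := congrArg Units.val h
  rwa [MonoidHom.coe_toHomUnits, Units.val_one] at h'

variable {K : Type*} [Group K] {H : Type*} [NormedAddCommGroup H] [InnerProductSpace ℂ H]

/-- **LEVEL OF A FINITE-DIMENSIONAL STABLE SUBSPACE**: `σ` a representation of `K` on a complex Hilbert space by bounded operators, `ιf : K_f →* K` from a profinite group with `k ↦ σ(ιf k) v`
continuous, `E ≤ H` a finite-dimensional `σ`-stable subspace.  THEN some OPEN SUBGROUP `U ≤ K_f` acts trivially on `E`: `σ (ιf u) v = v` (`u ∈ U`, `v ∈ E`).  (§1 applied to the norm-continuous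
representation on `E`, Mathlib `continuous_clm_apply`.) [cite: BorelJacquet1979, §1.2] [cite: MoeglinWaldspurger1995, I.2.17] -/
theorem exists_openSubgroup_forall_apply_eq (σ : ContRepresentation ℂ K H) (ιf : Kf →* K) (E : Submodule ℂ H) (hE : ∀ k, ∀ v ∈ E, σ k v ∈ E) [FiniteDimensional ℂ E]
    (hcont : ∀ v : H, v ∈ E → Continuous fun k : Kf => σ (ιf k) v) :
    ∃ U : OpenSubgroup Kf, ∀ u ∈ U, ∀ v ∈ E, σ (ιf u) v = v := by
  by_cases hEt : Nontrivial E
  swap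
  · refine ⟨⊤, fun u _ v hv => ?_⟩
    have h0 : v = 0 := by
      have : (⟨v, hv⟩ : E) = 0 := by
        rw [not_nontrivial_iff_subsingleton] at hEt
        exact Subsingleton.elim _ _
      simpa using congrArg Subtype.val this
    rw [h0, map_zero]
  -- the representation of `K_f` on `E` as a monoid hom into the Banach algebra `E →L[ℂ] E` (Mathlib `Module.End.toContinuousLinearMap`, `E` finite-dimensional)
  let ρ : Kf →* (E →L[ℂ] E) :=
    (MonoidHomClass.toMonoidHom (Module.End.toContinuousLinearMap (𝕜 := ℂ) E)).comp (((σ.subRep E hE) : K →* (E →ₗ[ℂ] E)).comp ιf)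
  have hρv : ∀ (k : Kf) (v : E), ((ρ k v : E) : H) = σ (ιf k) v := fun k v => rfl
  have hρc : Continuous ρ := by
    refine continuous_clm_apply.2 fun v => ?_
    have h1 : Continuous fun k : Kf => ((ρ k v : E) : H) := by
      simp only [hρv]
      exact hcont v v.2
    exact (continuous_induced_rng.2 h1 : Continuous fun k : Kf => ρ k v)
  obtain ⟨U, hU⟩ := exists_openSubgroup_forall_map_eq_one (𝔸 := E →L[ℂ] E) ρ hρc
  refine ⟨U, fun u hu v hv => ?_⟩
  have h := congrArg (fun T : E →L[ℂ] E => ((T ⟨v, hv⟩ : E) : H)) (hU u hu)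
  exact h

end Profinite

/-! ## §2 Schur: `K`-central elements act on an irreducible finite-dimensional `K`-type by scalars, forming a character -/

section Schur

variable {K : Type*} [Group K] {H : Type*} [NormedAddCommGroup H] [InnerProductSpace ℂ H]

/-- **SCHUR FOR A CENTRAL ELEMENT**: if `z` commutes with every element of `K`, then on an IRREDUCIBLE finite-dimensional stable `E` the operator `σ z` is a scalar (`σ_E(z)` is a
self-intertwiner; Mathlib `algebraMap_intertwiningMap_bijective_of_isAlgClosed`). [cite: Knapp1986, Prop. 1.5] -/
theorem exists_smul_of_forall_commute (σ : ContRepresentation ℂ K H) (E : Submodule ℂ H) (hE : ∀ k, ∀ v ∈ E, σ k v ∈ E) [FiniteDimensional ℂ E]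
    (hirr : (σ.subRep E hE).IsIrreducible) (z : K) (hz : ∀ k : K, z * k = k * z) :
    ∃ c : ℂ, ∀ v : H, v ∈ E → σ z v = c • v := by
  haveI := hirr
  let T : (σ.subRep E hE).IntertwiningMap (σ.subRep E hE) :=
    LinearMap.intertwiningMap_of_isIntertwiningMap (σ.subRep E hE) (σ.subRep E hE) ((σ.subRep E hE) z) fun k v => by
      rw [← Module.End.mul_apply, ← map_mul, hz k, map_mul, Module.End.mul_apply]
  obtain ⟨c, hc⟩ := (Representation.IsIrreducible.algebraMap_intertwiningMap_bijective_of_isAlgClosed (ρ := σ.subRep E hE)).2 T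
  refine ⟨c, fun v hv => ?_⟩
  have h := congrArg (fun S : (σ.subRep E hE).IntertwiningMap (σ.subRep E hE) => ((S ⟨v, hv⟩ : E) : H)) hc
  simp only [Representation.IntertwiningMap.algebraMap_apply, Representation.IntertwiningMap.smul_apply] at h
  -- `h : ((c • (1 : IntertwiningMap) ) ⟨v,hv⟩ : H) = (T ⟨v,hv⟩ : H)`
  rw [show ((T ⟨v, hv⟩ : E) : H) = σ z v from rfl] at h
  rw [← h]
  rfl

/-- **THE CENTRAL CHARACTER OF A `K`-TYPE**: along a hom `ιa : T →* K` whose image is central in `K` (e.g. `K = K_∞ × K_f`, `K_∞` abelian), an irreducible finite-dimensional `K`-type `E` carries a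
CHARACTER `χ : T →* ℂ` with `σ (ιa t) v = χ t • v` for `v ∈ E`. [cite: Knapp1986, Prop. 1.5] [cite: BorelJacquet1979, §1.2] -/
theorem exists_character_of_central {T : Type*} [Group T] (σ : ContRepresentation ℂ K H) (ι : T →* K) (hι : ∀ (t : T) (k : K), ι t * k = k * ι t)
    (E : Submodule ℂ H) (hE : ∀ k, ∀ v ∈ E, σ k v ∈ E) [FiniteDimensional ℂ E] (hirr : (σ.subRep E hE).IsIrreducible) :
    ∃ χ : T →* ℂ, ∀ (t : T) (v : H), v ∈ E → σ (ι t) v = χ t • v := by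
  haveI := hirr
  choose c hc using fun t => exists_smul_of_forall_commute σ E hE hirr (ι t) (hι t)
  -- a non-zero vector of `E` (irreducible ⇒ `E ≠ 0`)
  have hEne : ∃ v : H, v ∈ E ∧ v ≠ 0 := by
    by_contra hnot
    push Not at hnot
    refine (IsSimpleOrder.bot_ne_top (α := Subrepresentation (σ.subRep E hE))) (Subrepresentation.toSubmodule_injective ?_)
    show (⊥ : Submodule ℂ E) = ⊤
    exact ((Submodule.eq_bot_iff ⊤).2 fun w _ => Subtype.ext (hnot w w.2)).symm
  obtain ⟨v₀, hv₀, hv₀ne⟩ := hEne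
  refine ⟨{ toFun := c, map_one' := ?_, map_mul' := fun s t => ?_ }, fun t v hv => hc t v hv⟩
  · have h := hc 1 v₀ hv₀
    rw [map_one, map_one] at h
    have h' : (1 : ℂ) • v₀ = c 1 • v₀ := by rw [one_smul]; exact h
    exact (smul_left_injective ℂ hv₀ne h').symm
  · have h := hc (s * t) v₀ hv₀
    rw [map_mul, map_mul] at h
    have h' : σ (ι s) (σ (ι t) v₀) = c (s * t) • v₀ := h
    rw [hc t v₀ hv₀, map_smul, hc s v₀ hv₀, smul_smul] at h'
    exact ((smul_left_injective ℂ hv₀ne h').symm).trans (mul_comm _ _)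

end Schur

/-! ## §3 The isotypic component sits in `π^{(χ, U)}`; «`dim π^{(χ,U)} < ∞`» ⟹ `K`-admissibility -/

section Isotypic

variable {K : Type*} [Group K] {H : Type*} [NormedAddCommGroup H] [InnerProductSpace ℂ H]

/-- **`K`-MAPS CARRY THE RELATIONS OF `E` ALONG**: if `σ k₀` acts on `E` as the scalar `c`, it acts as `c` on the whole `E`-isotypic component ★ `homRangeSum σ E` (`σ k₀ (T w) = T (σ_E k₀ w) = c • T w`).
[cite: BorelJacquet1979, §1.2] -/
theorem homRangeSum_le_eigenspace (σ : ContRepresentation ℂ K H) (E : Submodule ℂ H) (hE : ∀ k, ∀ v ∈ E, σ k v ∈ E) (k₀ : K) (c : ℂ) (hk₀ : ∀ v : H, v ∈ E → σ k₀ v = c • v) :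
    Representation.homRangeSum σ.toRepresentation (σ.subRep E hE) ≤ Module.End.eigenspace ((σ k₀).toLinearMap) c := by
  refine iSup_le fun T => ?_
  rintro _ ⟨w, rfl⟩
  rw [Module.End.mem_eigenspace_iff]
  have h := Representation.IntertwiningMap.isIntertwining (σ.subRep E hE) σ.toRepresentation T k₀ w
  -- `h : T (σ_E k₀ w) = σ k₀ (T w)`
  have hw : (σ.subRep E hE) k₀ w = c • w := Subtype.ext (by rw [ContRepresentation.coe_subRep_apply, Submodule.coe_smul]; exact hk₀ w w.2)
  rw [hw, map_smul] at h
  rw [Representation.IntertwiningMap.toLinearMap_apply]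
  exact h.symm

/-- **THE ISOTYPIC COMPONENT OF A `K`-TYPE LIES IN SOME `π^{(χ, U)}`**: `ιa : T →* K` with central image, `ιf : K_f →* K` from a profinite group with continuous orbit maps on `E`, `E` an
irreducible finite-dimensional `K`-type.  THEN there are a character `χ : T →* ℂ` and an open subgroup `U ≤ K_f` with
`homRangeSum σ E ≤ (⨅_{u : U} Eig(σ(ιf u); 1)) ⊓ ⨅_t Eig(σ(ιa t); χ t)` — every vector of the `E`-isotypic component is `ιf(U)`-fixed and `χ`-isotypic. [cite: BorelJacquet1979, §1.2, §4.2] [cite: MoeglinWaldspurger1995, I.2.17] -/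
theorem exists_level_character_homRangeSum_le {T : Type*} [Group T] {Kf : Type*} [Group Kf] [TopologicalSpace Kf] [IsTopologicalGroup Kf] [CompactSpace Kf] [T2Space Kf]
    [TotallyDisconnectedSpace Kf] (σ : ContRepresentation ℂ K H) (ιa : T →* K) (hι : ∀ (t : T) (k : K), ιa t * k = k * ιa t) (ιf : Kf →* K)
    (E : Submodule ℂ H) (hE : ∀ k, ∀ v ∈ E, σ k v ∈ E) [FiniteDimensional ℂ E] (hirr : (σ.subRep E hE).IsIrreducible)
    (hcont : ∀ v : H, v ∈ E → Continuous fun k : Kf => σ (ιf k) v) :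
    ∃ (χ : T →* ℂ) (U : OpenSubgroup Kf), Representation.homRangeSum σ.toRepresentation (σ.subRep E hE) ≤
      (⨅ u : U, Module.End.eigenspace ((σ (ιf (u : Kf))).toLinearMap) 1) ⊓ ⨅ t : T, Module.End.eigenspace ((σ (ιa t)).toLinearMap) (χ t) := by
  obtain ⟨χ, hχ⟩ := exists_character_of_central σ ιa hι E hE hirr
  obtain ⟨U, hU⟩ := exists_openSubgroup_forall_apply_eq σ ιf E hE hcont
  refine ⟨χ, U, le_inf (le_iInf fun u => homRangeSum_le_eigenspace σ E hE _ 1 fun v hv => ?_) (le_iInf fun t => homRangeSum_le_eigenspace σ E hE _ _ (hχ t))⟩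
  rw [one_smul]
  exact hU u u.2 v hv

/-- **HEAD — K-TYPE ⇒ LEVEL REDUCTION OF ADMISSIBILITY.**  `σ` a representation of `K` by bounded operators on a complex Hilbert space (`σ = π.restrict ιK`), `ιa : T →* K` with `K`-central image,
`ιf : K_f →* K` from a profinite group with continuous orbit maps.  IF for every character `χ : T →* ℂ` and every open subgroup `U ≤ K_f` the space
`π^{(χ,U)} = (⨅_{u : U} Eig(σ(ιf u); 1)) ⊓ ⨅_t Eig(σ(ιa t); χ t)` of `U`-FIXED, `χ`-ISOTYPIC vectors is FINITE-DIMENSIONAL, THEN `σ` is `K`-ADMISSIBLE in the ★ `hadm` currency: every irreducible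
finite-dimensional `K`-type `E ≤ H` has a finite-dimensional isotypic component ★ `homRangeSum σ E`.  (In print: Langlands' «`dim 𝒜(G)^{(τ, K_f(𝔫))} < ∞`» ⟹ admissibility of `L²_res`.)
[cite: BorelJacquet1979, §1.2, §4.2] [cite: MoeglinWaldspurger1995, I.2.17] -/
theorem finiteDimensional_homRangeSum_of_level_finite {T : Type*} [Group T] {Kf : Type*} [Group Kf] [TopologicalSpace Kf] [IsTopologicalGroup Kf] [CompactSpace Kf] [T2Space Kf]
    [TotallyDisconnectedSpace Kf] (σ : ContRepresentation ℂ K H) (ιa : T →* K) (hι : ∀ (t : T) (k : K), ιa t * k = k * ιa t) (ιf : Kf →* K)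
    (hcont : ∀ v : H, Continuous fun k : Kf => σ (ιf k) v)
    (hfin : ∀ (χ : T →* ℂ) (U : OpenSubgroup Kf),
      FiniteDimensional ℂ ↥((⨅ u : U, Module.End.eigenspace ((σ (ιf (u : Kf))).toLinearMap) 1) ⊓ ⨅ t : T, Module.End.eigenspace ((σ (ιa t)).toLinearMap) (χ t)))
    (E : Submodule ℂ H) (hE : ∀ k, ∀ v ∈ E, σ k v ∈ E) [FiniteDimensional ℂ E] (hirr : (σ.subRep E hE).IsIrreducible) :
    FiniteDimensional ℂ (Representation.homRangeSum σ.toRepresentation (σ.subRep E hE)) := by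
  obtain ⟨χ, U, hle⟩ := exists_level_character_homRangeSum_le σ ιa hι ιf E hE hirr fun v _ => hcont v
  haveI := hfin χ U
  exact Submodule.finiteDimensional_of_le hle

end Isotypic

end Summit.HodgeConjecture.HodgeConjecture.Cruxes.H413.K2E1KTypeLevelReductionU

end
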